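import Literature.InformationTheory.Entanglement.MerminKlyshkoGHZ
import HarnessLib

/-!
# Svetlichny's inequality `|S_v| ≤ 4` for hybrid local–nonlocal models, and the GHZ value `4√2`

Topic `Literature/InformationTheory/Entanglement`, the “genuine tripartite nonlocality” member of
the family `CHSHInequality.lean` (CHSH), `GHZMermin.lean` (Mermin, `n = 3`),
`MerminKlyshkoInequality.lean` (all `n`), `MerminKlyshkoGHZ.lean` (quantum values).  Sources
(held texts, read at the cited places):

* J. Lavoie, R. Kaltenbaek, K. J. Resch, *Experimental violation of Svetlichny's inequality*,
  New J. Phys. 11, 073051 (2009) = arXiv:0909.0789 [LavoieKaltenbaekResch2009], §2 (Theory):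
  eq. (1) “`S₂ ≡ a(b + b′) + a′(b − b′) = ±2`, `S′₂ ≡ a′(b′ + b) + a(b′ − b) = ±2`”; eq. (3)
  “`S₃ ≡ S₂(c + c′) + S′₂(c − c′) = 2(a′bc + ab′c + abc′ − a′b′c′) = ±4`. Dividing this expression
  by two, and averaging over many trials yields Mermin's inequality”; “Now assume that we allow
  arbitrary (nonlocal) correlations between just two of the particles, say `a` and `b`, while we
  still assume local realism with respect to the third particle, `c`. … we can still write
  `S̃₂ = (ab) + (ab′) + (a′b) − (a′b′)`, `S̃′₂ = (a′b′) + (a′b) + (ab′) − (ab)`, where the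
  parentheses are meant as a reminder that these quantities should be regarded as separate and
  independent quantities. Each of these quantities as well as `c` and `c′` must take
  predetermined values `±1` … This model is strong enough to violate, and reach the algebraic
  maximum of Mermin's inequality (since `S̃₂` can be `±4`). Thus no experimental violation of
  Mermin's inequality can rule out this restricted nonlocal hidden-variable model”; eq. (6)
  “`S̃₂c − S̃′₂c′ = (ab)c + (ab)c′ + (ab′)c − (ab′)c′ + (a′b)c − (a′b)c′ − (a′b′)c − (a′b′)c′
  = ±4, ±2, 0`”; eq. (7) “Averaging over many trials yields the Svetlichny inequality:
  **`S_v ≡ |E(a,b,c) + E(a,b,c′) + E(a,b′,c) − E(a,b′,c′) + E(a′,b,c) − E(a′,b,c′) − E(a′,b′,c)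
  − E(a′,b′,c′)| ≤ 4`**”; “one gets an expression identical to (7) if `b` and `c` are nonlocally
  correlated while `a` is local, or if `a` and `c` are nonlocally correlated while `b` is local.
  Every hidden-variable model that allows for nonlocal correlations between any two particles but
  not between all three can be seen as a probabilistic combination of models where the partition
  … is made one or the other way. All of these models fulfill the Svetlichny inequality”; “It was
  shown by Svetlichny that his inequality can be violated by quantum predictions, and that the
  maximum violation can be achieved with GHZ states … this results in `S_v = 4√2 ≰ 4`, which is
  the maximum violation of Svetlichny's inequality achievable with quantum mechanics”.
* G. Svetlichny, Phys. Rev. D 35, 3066 (1987) — the primary source (cited through the above).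

HONEST FRAMING (pub-qadeq lane — ‘genuine tripartite nonlocality’ device demonstrations and
GHZ-state milestones): instance-level adjudication of specific advantage claims; no claim about
BQP vs BPP or the summit.  This file proves the hybrid-model bound and the quantum target;
nothing here concerns devices, loopholes or statistics.

## Contents (all proved, 0 named facts)

Settings are `Bool`s (`false` = unprimed, `true` = primed); `svet E` is the Svetlichny
combination of eq. (7) of a correlator table `E : Bool → Bool → Bool → ℝ`.

* **`svetlichny_pointwise`** — the deterministic core of eq. (6): for joint pair values
  `x = (ab), y = (ab′), z = (a′b), w = (a′b′)` and local values `c, c′`, all in `[−1,1]`,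
  `|c(x + y + z − w) + c′(x − y − z − w)| ≤ 4`; the same algebra serves the partitions `BC|A` and
  `AC|B` (“an expression identical to (7)”).  **`mermin_bilocal_reaches_four`**: the bilocal
  model reaches Mermin's algebraic maximum `4` (“`S̃₂` can be `±4`”).
* Hybrid models on a probability space `(Λ, μ)` of hidden variables with `[−1,1]`-valued
  a.e.-strongly-measurable responses — a JOINT response for the nonlocal pair (depending on both
  its settings) and a local response for the third particle: **`svetlichny_AB_C`**,
  **`svetlichny_BC_A`**, **`svetlichny_AC_B`** (`|S_v| ≤ 4` for each partition) and
  **`svetlichny_mixture`** (any probabilistic combination of the three obeys `|S_v| ≤ 4`).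
* Quantum side on the three-qubit register of `MerminKlyshkoGHZ.lean`: settings `a = b = σ_x`,
  `a′ = b′ = σ_y`, `c = (σ_x − σ_y)/√2`, `c′ = (σ_x + σ_y)/√2` (the xy-plane angles
  `0, π/2, −π/4, π/4`; the source's eq. (10) is another optimal choice) on `|GHZ₃⟩`:
  `expect_xyWord_ghz` (the eight `σ_x/σ_y` correlators `Re(i^{#y})`), **`svetlichny_ghz`**
  (`S_v = 4√2`) and `four_lt_svetlichny_ghz` (`4 < 4√2`: the hybrid bound is violated).

NOT formalised: that `4√2` is the quantum maximum [mitchell04], the `N`-particle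
generalisations [seevinck02, collins02], loophole analysis.

## Mathlib / tree search

Nothing on Svetlichny in Mathlib or the tree (`lean search 'Svetlichny'` empty).  Reused:
`LHV.integrable_mul_of_abs_le_one`, `LHV.abs_mul_le_one` (`CHSHInequality.lean`), `vecState`
(`TsirelsonBound.lean`), `obsWord`, `expect_obsWord_ghzPhase_pow`, `ghzPhase_one`
(`MerminKlyshkoGHZ.lean` / `GHZFidelityWitness.lean`).
-/

namespace Literature.InformationTheory.Entanglement

namespace Svetlichny

open MeasureTheory Matrix Complex Finset
open Literature.Computability.QuantumComplexity
open Literature.InformationTheory.Entanglement.Tsirelson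
open GHZWitness MerminKlyshkoGHZ

/-- The Svetlichny combination of a correlator table `E(s,t,u)` (`false` = unprimed setting):
`E(abc) + E(abc′) + E(ab′c) − E(ab′c′) + E(a′bc) − E(a′bc′) − E(a′b′c) − E(a′b′c′)`.
[cite: LavoieKaltenbaekResch2009, §2 eq. (7)] -/
def svet (E : Bool → Bool → Bool → ℝ) : ℝ :=
  E false false false + E false false true + E false true false - E false true true
    + E true false false - E true false true - E true true false - E true true true

/-! ## The deterministic core -/

/-- `|u + v| + |u − v| ≤ 4` for `|u|, |v| ≤ 2`. [folklore] -/
private theorem abs_add_abs_sub_le_four {u v : ℝ} (hu : |u| ≤ 2) (hv : |v| ≤ 2) :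
    |u + v| + |u - v| ≤ 4 := by
  obtain ⟨hu1, hu2⟩ := abs_le.mp hu
  obtain ⟨hv1, hv2⟩ := abs_le.mp hv
  rcases abs_cases (u + v) with ⟨h1, _⟩ | ⟨h1, _⟩ <;> rcases abs_cases (u - v) with ⟨h2, _⟩ | ⟨h2, _⟩ <;>
    rw [h1, h2] <;> linarith

/-- **Eq. (6), pointwise**: for joint pair values `x = (ab)`, `y = (ab′)`, `z = (a′b)`, `w = (a′b′)`
and local values `c`, `c′`, all in `[−1, 1]`,
`|(ab)c + (ab)c′ + (ab′)c − (ab′)c′ + (a′b)c − (a′b)c′ − (a′b′)c − (a′b′)c′| ≤ 4`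
(`= |c(x+y+z−w) + c′(x−y−z−w)| ≤ |x − w + (y + z)| + |x − w − (y + z)| ≤ 4`).
[cite: LavoieKaltenbaekResch2009, §2 eq. (6)] -/
theorem svetlichny_pointwise {x y z w c c' : ℝ} (hx : |x| ≤ 1) (hy : |y| ≤ 1) (hz : |z| ≤ 1)
    (hw : |w| ≤ 1) (hc : |c| ≤ 1) (hc' : |c'| ≤ 1) :
    |x * c + x * c' + y * c - y * c' + z * c - z * c' - w * c - w * c'| ≤ 4 := by
  have e : x * c + x * c' + y * c - y * c' + z * c - z * c' - w * c - w * c' =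
      c * ((x - w) + (y + z)) + c' * ((x - w) - (y + z)) := by ring
  rw [e]
  have hu : |x - w| ≤ 2 := by
    obtain ⟨_, _⟩ := abs_le.mp hx; obtain ⟨_, _⟩ := abs_le.mp hw
    rw [abs_le]; constructor <;> linarith
  have hv : |y + z| ≤ 2 := by
    obtain ⟨_, _⟩ := abs_le.mp hy; obtain ⟨_, _⟩ := abs_le.mp hz
    rw [abs_le]; constructor <;> linarith
  calc |c * ((x - w) + (y + z)) + c' * ((x - w) - (y + z))|
      ≤ |c * ((x - w) + (y + z))| + |c' * ((x - w) - (y + z))| := abs_add_le _ _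
    _ = |c| * |(x - w) + (y + z)| + |c'| * |(x - w) - (y + z)| := by rw [abs_mul, abs_mul]
    _ ≤ 1 * |(x - w) + (y + z)| + 1 * |(x - w) - (y + z)| := by gcongr
    _ ≤ 4 := by rw [one_mul, one_mul]; exact abs_add_abs_sub_le_four hu hv

/-- **The bilocal model reaches Mermin's algebraic maximum**: with joint values `(a′b) = (ab′) = 1`,
`(ab) = 1`, `(a′b′) = −1` and `c = c′ = 1`, Mermin's combination
`(a′b)c + (ab′)c + (ab)c′ − (a′b′)c′` equals `4` (“`S̃₂` can be `±4` … no experimental violation of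
Mermin's inequality can rule out this restricted nonlocal hidden-variable model”), whereas fully
local values give at most `2` (`GHZ.mermin_pointwise`). [cite: LavoieKaltenbaekResch2009, §2
(after eq. (5))] -/
theorem mermin_bilocal_reaches_four :
    ∃ x y z w c c' : ℝ, |x| ≤ 1 ∧ |y| ≤ 1 ∧ |z| ≤ 1 ∧ |w| ≤ 1 ∧ |c| ≤ 1 ∧ |c'| ≤ 1 ∧
      z * c + y * c + x * c' - w * c' = 4 :=
  ⟨1, 1, 1, -1, 1, 1, by norm_num⟩

/-! ## Hybrid local–nonlocal models -/

section Models

variable {Λ : Type*} [MeasurableSpace Λ] {μ : Measure Λ}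

/-- Combining the eight integrals of the Svetlichny combination into one. [folklore] -/
private theorem svet_integral [IsProbabilityMeasure μ] (F : Bool → Bool → Bool → Λ → ℝ)
    (hF : ∀ s t u, Integrable (F s t u) μ) :
    svet (fun s t u => ∫ l, F s t u l ∂μ) =
      ∫ l, (F false false false l + F false false true l + F false true false l
        - F false true true l + F true false false l - F true false true l
        - F true true false l - F true true true l) ∂μ := by
  unfold svet
  have i1 := hF false false false
  have i2 : Integrable (fun l => F false false false l + F false false true l) μ :=
    i1.add (hF _ _ _)
  have i3 : Integrable (fun l => F false false false l + F false false true l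
      + F false true false l) μ := i2.add (hF _ _ _)
  have i4 : Integrable (fun l => F false false false l + F false false true l
      + F false true false l - F false true true l) μ := i3.sub (hF _ _ _)
  have i5 : Integrable (fun l => F false false false l + F false false true l
      + F false true false l - F false true true l + F true false false l) μ := i4.add (hF _ _ _)
  have i6 : Integrable (fun l => F false false false l + F false false true l
      + F false true false l - F false true true l + F true false false l
      - F true false true l) μ := i5.sub (hF _ _ _)
  have i7 : Integrable (fun l => F false false false l + F false false true l
      + F false true false l - F false true true l + F true false false l
      - F true false true l - F true true false l) μ := i6.sub (hF _ _ _)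
  rw [integral_sub i7 (hF _ _ _), integral_sub i6 (hF _ _ _), integral_sub i5 (hF _ _ _),
    integral_add i4 (hF _ _ _), integral_sub i3 (hF _ _ _), integral_add i2 (hF _ _ _),
    integral_add i1 (hF _ _ _)]

/-- `|∫ f| ≤ 4` when `|f| ≤ 4` pointwise on a probability space. [folklore] -/
private theorem abs_integral_le_four [IsProbabilityMeasure μ] {f : Λ → ℝ} (hf : Integrable f μ)
    (h : ∀ l, |f l| ≤ 4) : |∫ l, f l ∂μ| ≤ 4 := by
  calc |∫ l, f l ∂μ| ≤ ∫ l, |f l| ∂μ := abs_integral_le_integral_abs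
    _ ≤ ∫ _l, (4 : ℝ) ∂μ := integral_mono hf.abs (integrable_const _) h
    _ = 4 := by rw [integral_const, smul_eq_mul, probReal_univ, one_mul]

/-- **Svetlichny's inequality, partition `AB|C`.**  Hidden variables `(Λ, μ)`; the pair `a, b` may
be arbitrarily (nonlocally) correlated — a joint `[−1,1]`-valued response `J s t` (the value of
the product `(ab)` for the settings `s, t`) — while `c` is local with response `C u`; then the
correlators `E(s,t,u) = ∫ J_{st} C_u dμ` satisfy `|S_v| ≤ 4`. [cite: LavoieKaltenbaekResch2009,
§2 eqs. (5)–(7)] -/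
theorem svetlichny_AB_C [IsProbabilityMeasure μ] {J : Bool → Bool → Λ → ℝ} {C : Bool → Λ → ℝ}
    (mJ : ∀ s t, AEStronglyMeasurable (J s t) μ) (mC : ∀ u, AEStronglyMeasurable (C u) μ)
    (hJ : ∀ s t l, |J s t l| ≤ 1) (hC : ∀ u l, |C u l| ≤ 1) :
    |svet (fun s t u => ∫ l, J s t l * C u l ∂μ)| ≤ 4 := by
  have hint : ∀ s t u, Integrable (fun l => J s t l * C u l) μ :=
    fun s t u => LHV.integrable_mul_of_abs_le_one (mJ s t) (mC u) (hJ s t) (hC u)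
  rw [svet_integral (fun s t u l => J s t l * C u l) hint]
  refine abs_integral_le_four ?_ fun l => ?_
  · exact ((((((hint _ _ _).add (hint _ _ _)).add (hint _ _ _)).sub (hint _ _ _)).add
      (hint _ _ _)).sub (hint _ _ _)).sub (hint _ _ _) |>.sub (hint _ _ _)
  · exact svetlichny_pointwise (hJ false false l) (hJ false true l) (hJ true false l)
      (hJ true true l) (hC false l) (hC true l)

/-- **Svetlichny's inequality, partition `BC|A`**: `a` local (response `A s`), the pair `b, c`
jointly (nonlocally) responding with `K t u ∈ [−1,1]`; `E(s,t,u) = ∫ A_s K_{tu} dμ` obeys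
`|S_v| ≤ 4` (“an expression identical to (7) if `b` and `c` are nonlocally correlated while `a` is
local”). [cite: LavoieKaltenbaekResch2009, §2 (after eq. (7))] -/
theorem svetlichny_BC_A [IsProbabilityMeasure μ] {A : Bool → Λ → ℝ} {K : Bool → Bool → Λ → ℝ}
    (mA : ∀ s, AEStronglyMeasurable (A s) μ) (mK : ∀ t u, AEStronglyMeasurable (K t u) μ)
    (hA : ∀ s l, |A s l| ≤ 1) (hK : ∀ t u l, |K t u l| ≤ 1) :
    |svet (fun s t u => ∫ l, A s l * K t u l ∂μ)| ≤ 4 := by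
  have hint : ∀ s t u, Integrable (fun l => A s l * K t u l) μ :=
    fun s t u => LHV.integrable_mul_of_abs_le_one (mA s) (mK t u) (hA s) (hK t u)
  rw [svet_integral (fun s t u l => A s l * K t u l) hint]
  refine abs_integral_le_four ?_ fun l => ?_
  · exact ((((((hint _ _ _).add (hint _ _ _)).add (hint _ _ _)).sub (hint _ _ _)).add
      (hint _ _ _)).sub (hint _ _ _)).sub (hint _ _ _) |>.sub (hint _ _ _)
  · -- `a(p+q+r−t) + a′(p−q−r−t)` with `p = (bc)`, `q = (bc′)`, `r = (b′c)`, `t = (b′c′)`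
    have h := svetlichny_pointwise (hK false false l) (hK false true l) (hK true false l)
      (hK true true l) (hA false l) (hA true l)
    have e : A false l * K false false l + A false l * K false true l + A false l * K true false l
        - A false l * K true true l + A true l * K false false l - A true l * K false true l
        - A true l * K true false l - A true l * K true true l =
        K false false l * A false l + K false false l * A true l + K false true l * A false l
        - K false true l * A true l + K true false l * A false l - K true false l * A true l
        - K true true l * A false l - K true true l * A true l := by ring
    rw [e]; exact h

/-- **Svetlichny's inequality, partition `AC|B`**: `b` local (response `B t`), the pair `a, c`
jointly responding with `L s u ∈ [−1,1]`; `E(s,t,u) = ∫ B_t L_{su} dμ` obeys `|S_v| ≤ 4` (“or if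
`a` and `c` are nonlocally correlated while `b` is local”). [cite: LavoieKaltenbaekResch2009, §2
(after eq. (7))] -/
theorem svetlichny_AC_B [IsProbabilityMeasure μ] {B : Bool → Λ → ℝ} {L : Bool → Bool → Λ → ℝ}
    (mB : ∀ t, AEStronglyMeasurable (B t) μ) (mL : ∀ s u, AEStronglyMeasurable (L s u) μ)
    (hB : ∀ t l, |B t l| ≤ 1) (hL : ∀ s u l, |L s u l| ≤ 1) :
    |svet (fun s t u => ∫ l, B t l * L s u l ∂μ)| ≤ 4 := by
  have hint : ∀ s t u, Integrable (fun l => B t l * L s u l) μ :=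
    fun s t u => LHV.integrable_mul_of_abs_le_one (mB t) (mL s u) (hB t) (hL s u)
  rw [svet_integral (fun s t u l => B t l * L s u l) hint]
  refine abs_integral_le_four ?_ fun l => ?_
  · exact ((((((hint _ _ _).add (hint _ _ _)).add (hint _ _ _)).sub (hint _ _ _)).add
      (hint _ _ _)).sub (hint _ _ _)).sub (hint _ _ _) |>.sub (hint _ _ _)
  · -- `b(p+q+r−t) + b′(p−q−r−t)` with `p = (ac)`, `q = (ac′)`, `r = (a′c)`, `t = (a′c′)`
    have h := svetlichny_pointwise (hL false false l) (hL false true l) (hL true false l)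
      (hL true true l) (hB false l) (hB true l)
    have e : B false l * L false false l + B false l * L false true l + B true l * L false false l
        - B true l * L false true l + B false l * L true false l - B false l * L true true l
        - B true l * L true false l - B true l * L true true l =
        L false false l * B false l + L false false l * B true l + L false true l * B false l
        - L false true l * B true l + L true false l * B false l - L true false l * B true l
        - L true true l * B false l - L true true l * B true l := by ring
    rw [e]; exact h

end Models

/-- **Probabilistic combinations of the three partitions** obey the same bound: if each
component model has `|S_v| ≤ 4` then so does any convex combination of their correlator tables
(“Every hidden-variable model that allows for nonlocal correlations between any two particles but
not between all three can be seen as a probabilistic combination … All of these models fulfill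
the Svetlichny inequality”). [cite: LavoieKaltenbaekResch2009, §2 (after eq. (7))] -/
theorem svetlichny_mixture {ι : Type*} (s : Finset ι) (q : ι → ℝ) (hq : ∀ i ∈ s, 0 ≤ q i)
    (hq1 : ∑ i ∈ s, q i = 1) (E : ι → Bool → Bool → Bool → ℝ) (hE : ∀ i ∈ s, |svet (E i)| ≤ 4) :
    |svet (fun a b c => ∑ i ∈ s, q i * E i a b c)| ≤ 4 := by
  have hlin : svet (fun a b c => ∑ i ∈ s, q i * E i a b c) = ∑ i ∈ s, q i * svet (E i) := by
    unfold svet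
    simp only [mul_add, mul_sub, Finset.sum_add_distrib, Finset.sum_sub_distrib]
  rw [hlin]
  calc |∑ i ∈ s, q i * svet (E i)| ≤ ∑ i ∈ s, |q i * svet (E i)| := Finset.abs_sum_le_sum_abs _ _
    _ = ∑ i ∈ s, q i * |svet (E i)| := Finset.sum_congr rfl fun i hi => by
        rw [abs_mul, abs_of_nonneg (hq i hi)]
    _ ≤ ∑ i ∈ s, q i * 4 := Finset.sum_le_sum fun i hi =>
        mul_le_mul_of_nonneg_left (hE i hi) (hq i hi)
    _ = 4 := by rw [← Finset.sum_mul, hq1, one_mul]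

/-! ## The quantum value `4√2` on `|GHZ₃⟩` -/

section Quantum

/-- The `σ_x/σ_y` correlators of `|GHZ₃⟩ = (|000⟩ + |111⟩)/√2`: `⟨O_s⟩ = Re(i^{#y(s)})` — `1` for
`xxx`, `−1` for the words with two `σ_y`, `0` for an odd number of `σ_y`.
[cite: LavoieKaltenbaekResch2009, §2 eq. (9) (the GHZ correlators `cos(φ_a + φ_b − φ_c)` in the
xy-plane)] -/
theorem expect_xyWord_ghz (s : Fin 3 → Bool) :
    vecState (ghzN 3) (obsWord s) = (I ^ (Finset.univ.filter fun j => s j = true).card).re := by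
  rw [← ghzPhase_one, expect_obsWord_ghzPhase_pow, star_one, one_mul]

/-- The setting word `(s₀, s₁, s₂)` as a function on `Fin 3`. [folklore] -/
private def word3 (s₀ s₁ s₂ : Bool) : Fin 3 → Bool := ![s₀, s₁, s₂]

/-- The eight `σ_x/σ_y` correlators of `|GHZ₃⟩` by parity of the number of `σ_y`. [folklore] -/
private theorem expect_word3 (s₀ s₁ s₂ : Bool) :
    vecState (ghzN 3) (obsWord (word3 s₀ s₁ s₂)) =
      if (s₀ ^^ s₁ ^^ s₂) then 0 else (if (s₀ || s₁ || s₂) && !(s₀ && s₁ && s₂) then -1 else 1) := by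
  rw [expect_xyWord_ghz]
  have hcard : (Finset.univ.filter fun j => word3 s₀ s₁ s₂ j = true).card =
      (if s₀ then 1 else 0) + (if s₁ then 1 else 0) + (if s₂ then 1 else 0) := by
    rw [Finset.card_filter, Fin.sum_univ_three]
    rfl
  rw [hcard]
  cases s₀ <;> cases s₁ <;> cases s₂ <;> simp [pow_succ, Complex.I_mul_I]

/-- The third party's rotated settings `c = (σ_x − σ_y)/√2` (`sgn = −1`) and `c′ = (σ_x + σ_y)/√2`
(`sgn = +1`) behind qubits `1, 2` measured along `σ^{(s₀)}, σ^{(s₁)}`: by multilinearity of the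
tensor product the observable is `(O_{(s₀,s₁,x)} + sgn·O_{(s₀,s₁,y)})/√2`.
[cite: LavoieKaltenbaekResch2009, §2 (measurement settings in the xy-plane)] -/
noncomputable def rotObs (s₀ s₁ : Bool) (sgn : ℝ) : Matrix (Fin 3 → Bool) (Fin 3 → Bool) ℂ :=
  (CHSHOpt.invSqrtTwo : ℝ) • (obsWord (word3 s₀ s₁ false) + sgn • obsWord (word3 s₀ s₁ true))

/-- The quantum correlator table of `|GHZ₃⟩` for the settings `a = b = σ_x`, `a′ = b′ = σ_y`,
`c = (σ_x − σ_y)/√2`, `c′ = (σ_x + σ_y)/√2`. [cite: LavoieKaltenbaekResch2009, §2 eq. (9)] -/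
noncomputable def ghzTable (s t u : Bool) : ℝ :=
  vecState (ghzN 3) (rotObs s t (if u then 1 else -1))

/-- The rotated correlators: `E(s, t, c) = (⟨O_{stx}⟩ − ⟨O_{sty}⟩)/√2`,
`E(s, t, c′) = (⟨O_{stx}⟩ + ⟨O_{sty}⟩)/√2`. [cite: LavoieKaltenbaekResch2009, §2 eq. (9)] -/
theorem ghzTable_eq (s t u : Bool) :
    ghzTable s t u = CHSHOpt.invSqrtTwo *
      (vecState (ghzN 3) (obsWord (word3 s t false)) +
        (if u then 1 else -1) * vecState (ghzN 3) (obsWord (word3 s t true))) := by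
  rw [ghzTable, rotObs, map_smul, map_add, map_smul, smul_eq_mul, smul_eq_mul]

/-- **`S_v(GHZ₃) = 4√2`** for `a = b = σ_x`, `a′ = b′ = σ_y`, `c = (σ_x − σ_y)/√2`,
`c′ = (σ_x + σ_y)/√2` (each of the four pairs of terms contributes `√2`).
[cite: LavoieKaltenbaekResch2009, §2 (“this results in `S_v = 4√2 ≰ 4`, which is the maximum
violation of Svetlichny's inequality achievable with quantum mechanics”)] -/
theorem svetlichny_ghz : svet ghzTable = 4 * Real.sqrt 2 := by
  unfold svet
  simp only [ghzTable_eq, expect_word3]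
  simp only [Bool.xor_false, Bool.xor_true, Bool.not_false, Bool.not_true, Bool.or_false,
    Bool.or_true, Bool.and_false, Bool.and_true, if_true, Bool.false_eq_true, if_false]
  rw [CHSHOpt.invSqrtTwo_eq]
  ring

/-- `4 < 4√2`: the GHZ value violates the hybrid-model bound. [cite: LavoieKaltenbaekResch2009,
§2] -/
theorem four_lt_svetlichny_ghz : 4 < svet ghzTable := by
  rw [svetlichny_ghz]
  have h : (1 : ℝ) < Real.sqrt 2 := by
    rw [show (1 : ℝ) = Real.sqrt 1 from Real.sqrt_one.symm]
    exact Real.sqrt_lt_sqrt (by norm_num) (by norm_num)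
  linarith

end Quantum

end Svetlichny

end Literature.InformationTheory.Entanglement
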